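import Mathlib.Analysis.SpecialFunctions.Sqrt
import Mathlib.Analysis.SpecialFunctions.Pow.Real
import Mathlib.Data.Real.Basic
import Mathlib.Data.Set.Finite.Basic
import Mathlib.Order.Interval.Set.Infinite
import Literature.Dynamics.NBody.AlbouyKaloshin2012
import HarnessLib

/-!
# Albouy–Kaloshin 2012: system (4), Definition 2, and the modified Roberts continuum (p. 543)

Topic `Literature/Dynamics/NBody`. Reproduction, kernel-checked, of a claim printed in
[AlbouyKaloshin2012] (Ann. of Math. 176 (2012) 535–588), §2 "Modified Roberts' continuum", p. 543:

> "We will consider a central configuration of Roberts' continuum. We change `m₅` in `−m₅`, `r_k5`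
> in `−r_k5`, `k = 1, …, 4`. We get a real normalized central configuration with positive masses
> (here we normalized with `y₁₃ = 0` instead of our usual `y₁₂ = 0`). Still this is not a positive
> normalized central configuration, as we choose for `r_k5` the negative square root of `z_k5 w_k5`.
> […] However, we get a continuum of solutions of (4) with positive masses."

with Roberts' continuum [Roberts1999 = AK12 ref. 26] as on p. 543: masses
`(1/2, 1/2, 1/2, 1/2, −1/8)`, a rhombus of unit side formed by bodies 1–4, body 5 at the centre.

What is typed here (pp. 540, 543):
* `IsRealNormalizedCC m q δ` — **Definition 2 / system (4)** of the paper restricted to real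
  unknowns: positions `q_k ∈ ℝ²`, inverse "distances" `δ_kl ∈ ℝ` (symmetric, either sign allowed),
  `δ_kl² · r_kl² = 1` for `k ≠ l`, the central-configuration equations
  `q_k = Σ_{l} m_l δ_kl³ (q_k − q_l)` (system (4): system (1) p. 535 with `r_kl⁻³ ↦ δ_kl³`; the
  `l = k` term vanishes), and the normalisation `y₁₂ = 0`. A *positive* normalized CC
  (Definition 1, typed in `AlbouyKaloshin2012.lean` as `IsPositiveNormalizedCC` — with the sign of
  `newtonForce` as corrected by the 2026-08-18 erratum, proposal p179210) is the case
  `δ_kl = +r_kl⁻¹`; this file does not need that bridge and does not state it. The sign used HERE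
  is the paper's: `q_k = Σ_l m_l δ_kl³ (q_k − q_l)` (p. 535: `x_kl = x_l − x_k`, `q̈_k = −f_k`).
* `robertsMasses = (1/2,1/2,1/2,1/2,1/8)` (∝ `(4,4,4,4,1)`, Remark 8 p. 583) and the explicit
  family `robertsQ a b`, `robertsDelta a b` (bodies renumbered so that the paper's normalisation
  `y₁₂ = 0` holds without rotation: bodies 1,2 at `(±a,0)`, bodies 3,4 at `(0,±b)`, body 5 at the
  origin, `a² + b² = 1`; `δ = 1` on the four unit sides, `δ₁₂ = 1/(2a)`, `δ₃₄ = 1/(2b)`, and the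
  NEGATIVE `δ_k5 = −1/a` (k = 1,2), `−1/b` (k = 3,4)).
* `robertsFamily_isRealNormalizedCC` — every member with `a ≠ 0`, `b ≠ 0`, `a² + b² = 1` solves
  system (4) (pure algebra: `field_simp`/`ring`; only the four side equations use `a² + b² = 1`).
* `realNormalizedCCs_robertsMasses_infinite` — hence the set of real normalized central
  configurations (Definition 2) for the POSITIVE mass vector `(1/2,1/2,1/2,1/2,1/8)` is infinite:
  the conclusion of the paper's Theorem 6 (finiteness of normalized CCs, p. 581) fails at this
  point of the exceptional set `A` (it lies on `m₁ = m₂ ∧ m₃ = m₄`, relation (32) p. 576), exactly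
  as the paper says (Remark 8). Theorem 2 (positive CCs) is not contradicted: these solutions have
  `δ_k5 < 0`.

Why this matters for the `pub-smale6` cell (papers/_external/smale6-n5): any certificate of
"finiteness on the component `{m₁=m₂, m₃=m₄}`" by zero-dimensionality of the complexified /
sign-relaxed system (4) is impossible uniformly on that component — the polynomial system IS
positive-dimensional at `(4,4,4,4,1)` and its `S₅`-images. Exact cross-check outside Lean:
`run/shared/lean/pub/pub-smale6/certs/roberts_continuum/` (sympy, residuals reduced modulo
`a²+b²−1`, and the rational parametrisation `a=(1−t²)/(1+t²)`, `b=2t/(1+t²)`).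
-/

namespace Literature.Dynamics.NBody

open Finset

/-- **System (4) / Definition 2** of [AlbouyKaloshin2012] (p. 540) over the reals: a *real
normalized central configuration* for masses `m` is a pair (positions `q`, inverse distances `δ`)
with `δ` symmetric, `δ_kl² ((x_l−x_k)² + (y_l−y_k)²) = 1` for `k ≠ l` (so `δ_kl = ± r_kl⁻¹`, either
sign), `q_k = Σ_l m_l δ_kl³ (q_k − q_l)` for every `k` (system (1) with `r_kl⁻³ ↦ δ_kl³`), and
`y₁₂ = 0`. [cite: AlbouyKaloshin2012, system (4) and Definition 2, p. 540] -/
def IsRealNormalizedCC {n : ℕ} (m : Fin n → ℝ) (q : Fin n → ℝ × ℝ) (δ : Fin n → Fin n → ℝ) :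
    Prop :=
  (∀ k l : Fin n, δ k l = δ l k) ∧
  (∀ k l : Fin n, k ≠ l → δ k l ^ 2 * sqDist (q k) (q l) = 1) ∧
  (∀ k : Fin n, q k = ∑ l, (m l * δ k l ^ 3) • (q k - q l)) ∧
  (∀ h0 : 0 < n, ∀ h1 : 1 < n, (q ⟨1, h1⟩).2 = (q ⟨0, h0⟩).2)

/-- The set of real normalized central configurations (Definition 2, p. 540) for masses `m`.
[cite: AlbouyKaloshin2012, Definition 2 p. 540] -/
def realNormalizedCCs {n : ℕ} (m : Fin n → ℝ) : Set ((Fin n → ℝ × ℝ) × (Fin n → Fin n → ℝ)) :=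
  {c | IsRealNormalizedCC m c.1 c.2}

/-- The positive mass vector `(1/2, 1/2, 1/2, 1/2, 1/8)` of the modified Roberts continuum
([AlbouyKaloshin2012] p. 543; `∝ (4,4,4,4,1)`, Remark 8 p. 583).
[cite: AlbouyKaloshin2012, p. 543] -/
noncomputable def robertsMasses : Fin 5 → ℝ := ![1/2, 1/2, 1/2, 1/2, 1/8]

/-- Positions of the (renumbered) Roberts rhombus: bodies 1,2 at `(±a, 0)`, bodies 3,4 at
`(0, ±b)`, body 5 at the origin. [cite: AlbouyKaloshin2012, p. 543] -/
def robertsQ (a b : ℝ) : Fin 5 → ℝ × ℝ := ![(a, 0), (-a, 0), (0, b), (0, -b), (0, 0)]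

/-- Inverse distances of the MODIFIED Roberts continuum: `+1` on the four rhombus sides
(`r = 1` when `a² + b² = 1`), `1/(2a)` and `1/(2b)` on the diagonals, and the negative choices
`δ_k5 = −r_k5⁻¹` towards the central body (p. 543: "we choose for `r_k5` the negative square root").
[cite: AlbouyKaloshin2012, p. 543] -/
noncomputable def robertsDelta (a b : ℝ) : Fin 5 → Fin 5 → ℝ :=
  ![![0, 1 / (2 * a), 1, 1, -1 / a],
    ![1 / (2 * a), 0, 1, 1, -1 / a],
    ![1, 1, 0, 1 / (2 * b), -1 / b],
    ![1, 1, 1 / (2 * b), 0, -1 / b],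
    ![-1 / a, -1 / a, -1 / b, -1 / b, 0]]

/-- Every member of the modified Roberts family (`a ≠ 0`, `b ≠ 0`, `a² + b² = 1`) is a real
normalized central configuration (solution of system (4)) for the positive masses
`(1/2,1/2,1/2,1/2,1/8)`. [cite: AlbouyKaloshin2012, p. 543 "we get a continuum of solutions of (4)
with positive masses"] -/
theorem robertsFamily_isRealNormalizedCC (a b : ℝ) (ha : a ≠ 0) (hb : b ≠ 0)
    (hab : a ^ 2 + b ^ 2 = 1) :
    IsRealNormalizedCC robertsMasses (robertsQ a b) (robertsDelta a b) := by
  refine ⟨?_, ?_, ?_, ?_⟩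
  · intro k l
    fin_cases k <;> fin_cases l <;> simp [robertsDelta]
  · intro k l hkl
    fin_cases k <;> fin_cases l <;>
      simp [robertsDelta, robertsQ, sqDist] at hkl ⊢ <;> field_simp <;> nlinarith [hab]
  · intro k
    fin_cases k <;>
      simp [robertsMasses, robertsDelta, robertsQ, Fin.sum_univ_five, Prod.ext_iff] <;>
      field_simp <;> ring
  · intro h0 h1
    simp [robertsQ]

/-- Distinct parameters `a` give distinct configurations (the first body sits at `(a, 0)`). [folklore] -/
theorem robertsQ_fst_eq {a b a' b' : ℝ} (h : robertsQ a b = robertsQ a' b') : a = a' := by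
  have := congrArg (fun q : Fin 5 → ℝ × ℝ => (q 0).1) h
  simpa [robertsQ] using this

/-- **The modified Roberts continuum** ([AlbouyKaloshin2012] p. 543, Remark 8 p. 583): for the
positive masses `(1/2,1/2,1/2,1/2,1/8)` the set of real normalized central configurations
(Definition 2 / system (4)) is infinite. [cite: AlbouyKaloshin2012, p. 543] -/
theorem realNormalizedCCs_robertsMasses_infinite : (realNormalizedCCs robertsMasses).Infinite := by
  -- the curve a ↦ (robertsQ a b(a), robertsDelta a b(a)), b(a) = √(1 − a²), over a ∈ (0,1)
  let f : ℝ → (Fin 5 → ℝ × ℝ) × (Fin 5 → Fin 5 → ℝ) :=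
    fun a => (robertsQ a (Real.sqrt (1 - a ^ 2)), robertsDelta a (Real.sqrt (1 - a ^ 2)))
  have hinj : Set.InjOn f (Set.Ioo (0 : ℝ) 1) := by
    intro a _ a' _ h
    exact robertsQ_fst_eq (congrArg Prod.fst h)
  have hsub : f '' Set.Ioo (0 : ℝ) 1 ⊆ realNormalizedCCs robertsMasses := by
    rintro _ ⟨a, ⟨ha0, ha1⟩, rfl⟩
    have hpos : 0 < 1 - a ^ 2 := by nlinarith
    have hb : Real.sqrt (1 - a ^ 2) ≠ 0 := (Real.sqrt_pos.mpr hpos).ne'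
    have hab : a ^ 2 + Real.sqrt (1 - a ^ 2) ^ 2 = 1 := by
      rw [Real.sq_sqrt hpos.le]; ring
    exact robertsFamily_isRealNormalizedCC a _ ha0.ne' hb hab
  exact ((Set.Ioo_infinite (zero_lt_one' ℝ)).image hinj).mono hsub

end Literature.Dynamics.NBody
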